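import Summits.Parity.GeneralizedHardyLittlewood.Theses.LiouvilleShiftedTables
import Summits.Parity.GeneralizedHardyLittlewood.Theorems.DilatedTableChowla.Negative.DilatedTableChowlaLargeDilations

/-!
# The generic two-point core of `DilatedTableChowla` (stmt-Parity-14271), line `positivity-quarantine`

Support file for the crux `LiouvilleShiftedTables.DilatedTableChowla` (lead prover of the line
`positivity-quarantine`, stub `stub_genericAffineTable` = (C⁺) "generic affine Table-Chowla at the
one-point interface").  Three kernel-checked certificates about the SIZE of that stub:

* `genericAffineTable_of_dilatedTableChowla` — the crux implies (C⁺) outright (Markov's inequality on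
  the harmonic `ℓ¹`-average: the dilations violating the pointwise bound `q⁴F ≤ x²/(log x)^C` have
  harmonic mass `≤ (log x)^{-C-1}` under the crux at exponent `2C+1`); together with the line's
  composition `(Z1) ∧ (Z2) ∧ (★) ∧ (C⁺) → crux` (skeleton `Lines/positivity-quarantine.lean`, with
  (Z1), (Z2) landed) this makes (C⁺) EQUIVALENT to the crux: the line relocates, and does not
  reduce, the two-point content — exactly as its card said ("crux-implied up to logs").
* `genericAffineTable_of_tableChowla_of_largeDilations` — (C⁺) splits as the sibling crux
  `TableChowla` (stmt-Parity-14270, the `q = 1` table, used for ALL small dilations `q ≤ (log x)^{K₀}`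
  through positivity of Gram fourth moments under row/column deletion, the tree's
  `Negative.gram_mono` of `DilatedTableChowlaLargeDilations`) plus the
  LARGE-DILATION core `(log x)^{K₀} < q ≤ x^{δ/2}` (generic `q`, pointwise, one-point data as
  hypothesis, `K₀` of the prover's choosing).  This is the glue for the planner's foreseen split
  `DilatedTableChowla ⇐ TableChowla → SmallDilations → GenericDilations`, with `SmallDilations`
  shown to be FREE.

All statements are written in the crux's own vocabulary (no new definitions). [folklore]
-/

namespace Summit.Parity.GeneralizedHardyLittlewood.Theorems.DilatedTableChowla.GenericCore

open Finset
open Summit.Parity.GeneralizedHardyLittlewood.Theses.LiouvilleShiftedTables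

/-! ### Abstract bookkeeping -/

/-- MARKOV ON THE HARMONIC AVERAGE: if `Σ_{q ≤ Q} q³ G(q) ≤ T` with `G ≥ 0`, then the `q ≤ Q` with
`q⁴ G(q) > X` have harmonic mass `Σ 1/q ≤ T/X`. [folklore] -/
theorem markov_harmonic {Q : ℕ} {G : ℕ → ℝ} (hG : ∀ q, 0 ≤ G q) {X T : ℝ} (hX : 0 < X)
    (hsum : ∑ q ∈ Icc 1 Q, (q : ℝ) ^ 3 * G q ≤ T) :
    ∑ q ∈ (Icc 1 Q).filter (fun q : ℕ => X < (q : ℝ) ^ 4 * G q), ((q : ℝ))⁻¹ ≤ T / X := by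
  have hT : ∑ q ∈ Icc 1 Q, (q : ℝ) ^ 3 * G q * X⁻¹ ≤ T / X := by
    rw [← Finset.sum_mul, div_eq_mul_inv]
    exact mul_le_mul_of_nonneg_right hsum (inv_nonneg.2 hX.le)
  refine le_trans ?_ (le_trans (Finset.sum_le_sum_of_subset_of_nonneg
    (Finset.filter_subset (fun q : ℕ => X < (q : ℝ) ^ 4 * G q) _)
    fun q _ _ => by have := hG q; positivity) hT)
  refine Finset.sum_le_sum fun q hq => ?_
  obtain ⟨hqI, hlt⟩ := Finset.mem_filter.1 hq
  have hq1 : (1 : ℝ) ≤ q := by exact_mod_cast (Finset.mem_Icc.1 hqI).1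
  have hqpos : (0 : ℝ) < q := by linarith
  -- `1/q = q⁻¹ · X · X⁻¹ ≤ q⁻¹ · (q⁴ G) · X⁻¹ = q³ G X⁻¹`
  calc ((q : ℝ))⁻¹ = ((q : ℝ))⁻¹ * X * X⁻¹ := by field_simp
    _ ≤ ((q : ℝ))⁻¹ * ((q : ℝ) ^ 4 * G q) * X⁻¹ := by gcongr
    _ = (q : ℝ) ^ 3 * G q * X⁻¹ := by field_simp

/-- `1 ≤ log x` for `x ≥ exp 1`. [folklore] -/
theorem one_le_log_of_exp_one_le {x : ℝ} (hx : Real.exp 1 ≤ x) : 1 ≤ Real.log x := by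
  rw [← Real.log_exp 1]
  exact Real.log_le_log (Real.exp_pos 1) hx

/-! ### The crux implies its generic core (C⁺) -/

/-- **The crux implies (C⁺).** `DilatedTableChowla → GenericAffineTable` (the registered stub
`stub_genericAffineTable` of the line `positivity-quarantine`, written out): under the crux at
exponent `2C+1`, the set `E'` of dilations `q ≤ x^{δ/2}` with `q⁴F(q) > x²/(log x)^C` has harmonic
mass `≤ (log x)^{-C-1} ≤ (log x)^{-C}` (Markov), and off `E'` the pointwise bound holds by
definition; the one-point hypothesis is not even used.  So (C⁺) is crux-implied (Disproof §11 made
exact), hence — with the line's composition — EQUIVALENT to the crux. [folklore] -/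
theorem genericAffineTable_of_dilatedTableChowla (h : DilatedTableChowla) :
    ∀ c : ℤ, c ≠ 0 → ∀ δ : ℝ, 0 < δ → δ ≤ 1 / 12 → ∀ C : ℝ, 0 < C → ∃ B κ : ℝ, 0 < κ ∧
    ∃ x₀ : ℝ, ∀ x : ℝ, x₀ ≤ x → ∀ A : ℝ, x ^ δ ≤ A → A ≤ x ^ (1 / 3 + δ) → ∀ u v : ℕ → ℕ,
      ∃ E' : Finset ℕ, (∑ q ∈ E', ((q : ℝ))⁻¹) ≤ (Real.log x ^ C)⁻¹ ∧
        ∀ q : ℕ, 1 ≤ q → q ≤ ⌊x ^ (δ / 2)⌋₊ → q ∉ E' →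
          (∀ n : ℕ, q ∣ n → (n : ℝ) ≤ q * Real.log x ^ κ → ∀ [NeZero n],
            ∀ χ : DirichletCharacter ℂ n, ∀ y : ℝ, x ^ (1 / 2 : ℝ) ≤ y → y ≤ x ^ 2 →
              ‖∑ k ∈ Finset.Icc 1 ⌊y⌋₊, (ArithmeticFunction.liouville k : ℂ) * χ (k : ZMod n)‖ ≤
                y / Real.log x ^ B) →
          (q : ℝ) ^ 4 *
            (∑ a ∈ (Finset.Ioc ⌊A⌋₊ ⌊2 * A⌋₊).filter (fun a : ℕ => a ≡ u q [MOD q]),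
              ∑ a' ∈ (Finset.Ioc ⌊A⌋₊ ⌊2 * A⌋₊).filter (fun a' : ℕ => a' ≡ u q [MOD q]),
                (∑ b ∈ (Finset.Icc 1 ⌊x / A⌋₊).filter (fun b : ℕ => b ≡ v q [MOD q]),
                  (ArithmeticFunction.liouville (Int.toNat ((a : ℤ) * b + c)) : ℝ) *
                    (ArithmeticFunction.liouville (Int.toNat ((a' : ℤ) * b + c)) : ℝ)) ^ 2)
            ≤ x ^ 2 / Real.log x ^ C := by
  intro c hc δ hδ hδ' C hC
  obtain ⟨x₀, hx₀⟩ := h c hc δ hδ hδ' (2 * C + 1) (by linarith)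
  refine ⟨0, 1, one_pos, max x₀ (Real.exp 1), fun x hx A hA1 hA2 u v => ?_⟩
  have hxx₀ : x₀ ≤ x := le_trans (le_max_left _ _) hx
  have hxe : Real.exp 1 ≤ x := le_trans (le_max_right _ _) hx
  have hxpos : 0 < x := lt_of_lt_of_le (Real.exp_pos 1) hxe
  have hL1 : 1 ≤ Real.log x := one_le_log_of_exp_one_le hxe
  have hLpos : 0 < Real.log x := by linarith
  have hLC : 0 < Real.log x ^ C := Real.rpow_pos_of_pos hLpos C
  have hX : 0 < x ^ 2 / Real.log x ^ C := by positivity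
  -- the block moment as a function of the dilation
  set G : ℕ → ℝ := fun q =>
    ∑ a ∈ (Finset.Ioc ⌊A⌋₊ ⌊2 * A⌋₊).filter (fun a : ℕ => a ≡ u q [MOD q]),
      ∑ a' ∈ (Finset.Ioc ⌊A⌋₊ ⌊2 * A⌋₊).filter (fun a' : ℕ => a' ≡ u q [MOD q]),
        (∑ b ∈ (Finset.Icc 1 ⌊x / A⌋₊).filter (fun b : ℕ => b ≡ v q [MOD q]),
          (ArithmeticFunction.liouville (Int.toNat ((a : ℤ) * b + c)) : ℝ) *
            (ArithmeticFunction.liouville (Int.toNat ((a' : ℤ) * b + c)) : ℝ)) ^ 2 with hGdef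
  have hGnn : ∀ q, 0 ≤ G q := fun q =>
    Finset.sum_nonneg fun _ _ => Finset.sum_nonneg fun _ _ => sq_nonneg _
  have hmain : ∑ q ∈ Icc 1 ⌊x ^ (δ / 2)⌋₊, (q : ℝ) ^ 3 * G q ≤ x ^ 2 / Real.log x ^ (2 * C + 1) :=
    hx₀ x hxx₀ A hA1 hA2 u v
  refine ⟨(Icc 1 ⌊x ^ (δ / 2)⌋₊).filter (fun q : ℕ => x ^ 2 / Real.log x ^ C < (q : ℝ) ^ 4 * G q),
    ?_, ?_⟩
  · -- Markov
    refine (markov_harmonic hGnn hX hmain).trans ?_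
    have hsplit : Real.log x ^ (2 * C + 1) = Real.log x ^ C * Real.log x ^ C * Real.log x := by
      rw [show (2 : ℝ) * C + 1 = C + C + 1 by ring, Real.rpow_add hLpos, Real.rpow_add hLpos,
        Real.rpow_one]
    rw [hsplit, div_le_iff₀ hX]
    -- `x²/(L^C L^C L) ≤ (L^C)⁻¹ · (x²/L^C)` ⟸ `L ≥ 1`
    rw [div_le_iff₀ (by positivity)]
    have key : x ^ 2 ≤ x ^ 2 * Real.log x := le_mul_of_one_le_right (by positivity) hL1
    calc x ^ 2 ≤ x ^ 2 * Real.log x := key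
      _ = (Real.log x ^ C)⁻¹ * (x ^ 2 / Real.log x ^ C) *
            (Real.log x ^ C * Real.log x ^ C * Real.log x) := by field_simp
  · intro q hq1 hqQ hqE _hone
    by_contra hlt
    push Not at hlt
    exact hqE (Finset.mem_filter.2 ⟨Finset.mem_Icc.2 ⟨hq1, hqQ⟩, hlt⟩)

/-! ### (C⁺) splits as `TableChowla` (all small dilations) + the large-dilation core -/

/-- **(C⁺) from `TableChowla` and the LARGE-DILATION core.** If the sibling crux `TableChowla`
(stmt-Parity-14270) holds and the pointwise generic bound holds for the dilations
`(log x)^{K₀} < q ≤ x^{δ/2}` (for some `K₀` of the prover's choosing, off a harmonically sparse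
`E'`, with the one-point data as hypothesis — the last displayed hypothesis), then (C⁺)
`GenericAffineTable` holds: for `q ≤ (log x)^{K₀}` the class-restricted block is entrywise a
sub-table of the full `q = 1` table, so by positivity of Gram fourth moments (`Negative.gram_mono`)
`q⁴F(q,u,v) ≤ (log x)^{4K₀} F(1) ≤ x²/(log x)^C` from `TableChowla` at exponent `C + 4K₀`.
So the route's foreseen `SmallDilations` node is free, and the residual content of (C⁺) beyond
stmt-Parity-14270 is exactly the large-dilation core. [folklore] -/
theorem genericAffineTable_of_tableChowla_of_largeDilations (hT : TableChowla)
    (hLarge : ∀ c : ℤ, c ≠ 0 → ∀ δ : ℝ, 0 < δ → δ ≤ 1 / 12 → ∀ C : ℝ, 0 < C →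
      ∃ K₀ B κ : ℝ, 0 < κ ∧ ∃ x₀ : ℝ, ∀ x : ℝ, x₀ ≤ x → ∀ A : ℝ, x ^ δ ≤ A → A ≤ x ^ (1 / 3 + δ) →
      ∀ u v : ℕ → ℕ, ∃ E' : Finset ℕ, (∑ q ∈ E', ((q : ℝ))⁻¹) ≤ (Real.log x ^ C)⁻¹ ∧
        ∀ q : ℕ, Real.log x ^ K₀ < q → q ≤ ⌊x ^ (δ / 2)⌋₊ → q ∉ E' →
          (∀ n : ℕ, q ∣ n → (n : ℝ) ≤ q * Real.log x ^ κ → ∀ [NeZero n],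
            ∀ χ : DirichletCharacter ℂ n, ∀ y : ℝ, x ^ (1 / 2 : ℝ) ≤ y → y ≤ x ^ 2 →
              ‖∑ k ∈ Finset.Icc 1 ⌊y⌋₊, (ArithmeticFunction.liouville k : ℂ) * χ (k : ZMod n)‖ ≤
                y / Real.log x ^ B) →
          (q : ℝ) ^ 4 *
            (∑ a ∈ (Finset.Ioc ⌊A⌋₊ ⌊2 * A⌋₊).filter (fun a : ℕ => a ≡ u q [MOD q]),
              ∑ a' ∈ (Finset.Ioc ⌊A⌋₊ ⌊2 * A⌋₊).filter (fun a' : ℕ => a' ≡ u q [MOD q]),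
                (∑ b ∈ (Finset.Icc 1 ⌊x / A⌋₊).filter (fun b : ℕ => b ≡ v q [MOD q]),
                  (ArithmeticFunction.liouville (Int.toNat ((a : ℤ) * b + c)) : ℝ) *
                    (ArithmeticFunction.liouville (Int.toNat ((a' : ℤ) * b + c)) : ℝ)) ^ 2)
            ≤ x ^ 2 / Real.log x ^ C) :
    ∀ c : ℤ, c ≠ 0 → ∀ δ : ℝ, 0 < δ → δ ≤ 1 / 12 → ∀ C : ℝ, 0 < C → ∃ B κ : ℝ, 0 < κ ∧
    ∃ x₀ : ℝ, ∀ x : ℝ, x₀ ≤ x → ∀ A : ℝ, x ^ δ ≤ A → A ≤ x ^ (1 / 3 + δ) → ∀ u v : ℕ → ℕ,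
      ∃ E' : Finset ℕ, (∑ q ∈ E', ((q : ℝ))⁻¹) ≤ (Real.log x ^ C)⁻¹ ∧
        ∀ q : ℕ, 1 ≤ q → q ≤ ⌊x ^ (δ / 2)⌋₊ → q ∉ E' →
          (∀ n : ℕ, q ∣ n → (n : ℝ) ≤ q * Real.log x ^ κ → ∀ [NeZero n],
            ∀ χ : DirichletCharacter ℂ n, ∀ y : ℝ, x ^ (1 / 2 : ℝ) ≤ y → y ≤ x ^ 2 →
              ‖∑ k ∈ Finset.Icc 1 ⌊y⌋₊, (ArithmeticFunction.liouville k : ℂ) * χ (k : ZMod n)‖ ≤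
                y / Real.log x ^ B) →
          (q : ℝ) ^ 4 *
            (∑ a ∈ (Finset.Ioc ⌊A⌋₊ ⌊2 * A⌋₊).filter (fun a : ℕ => a ≡ u q [MOD q]),
              ∑ a' ∈ (Finset.Ioc ⌊A⌋₊ ⌊2 * A⌋₊).filter (fun a' : ℕ => a' ≡ u q [MOD q]),
                (∑ b ∈ (Finset.Icc 1 ⌊x / A⌋₊).filter (fun b : ℕ => b ≡ v q [MOD q]),
                  (ArithmeticFunction.liouville (Int.toNat ((a : ℤ) * b + c)) : ℝ) *
                    (ArithmeticFunction.liouville (Int.toNat ((a' : ℤ) * b + c)) : ℝ)) ^ 2)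
            ≤ x ^ 2 / Real.log x ^ C := by
  intro c hc δ hδ hδ' C hC
  obtain ⟨K₀, B, κ, hκ, x₁, h₁⟩ := hLarge c hc δ hδ hδ' C hC
  set K : ℝ := max K₀ 0 with hKdef
  have hK0 : 0 ≤ K := le_max_right _ _
  obtain ⟨x₂, h₂⟩ := hT c hc δ hδ hδ' (C + 4 * K) (by positivity)
  refine ⟨B, κ, hκ, max (max x₁ x₂) (Real.exp 1), fun x hx A hA1 hA2 u v => ?_⟩
  have hx1 : x₁ ≤ x := le_trans (le_trans (le_max_left _ _) (le_max_left _ _)) hx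
  have hx2 : x₂ ≤ x := le_trans (le_trans (le_max_right _ _) (le_max_left _ _)) hx
  have hxe : Real.exp 1 ≤ x := le_trans (le_max_right _ _) hx
  have hxpos : 0 < x := lt_of_lt_of_le (Real.exp_pos 1) hxe
  have hL1 : 1 ≤ Real.log x := one_le_log_of_exp_one_le hxe
  have hLpos : 0 < Real.log x := by linarith
  obtain ⟨E', hE', hlarge⟩ := h₁ x hx1 A hA1 hA2 u v
  refine ⟨E', hE', fun q hq1 hqQ hqE hone => ?_⟩
  rcases lt_or_ge (Real.log x ^ K₀) (q : ℝ) with hbig | hsmall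
  · exact hlarge q hbig hqQ hqE hone
  · -- small dilations: positivity + `TableChowla` at exponent `C + 4K`
    have htable := h₂ x hx2 A hA1 hA2
    have hqK : (q : ℝ) ≤ Real.log x ^ K :=
      hsmall.trans (Real.rpow_le_rpow_of_exponent_le hL1 (le_max_left _ _))
    have hqpos : (0 : ℝ) < q := by exact_mod_cast hq1
    -- block ≤ full table
    have hsub := Negative.gram_mono
      (fun a b => (ArithmeticFunction.liouville (Int.toNat ((a : ℤ) * b + c)) : ℝ))
      ((Finset.Ioc ⌊A⌋₊ ⌊2 * A⌋₊).filter (fun a : ℕ => a ≡ u q [MOD q]))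
      (Finset.Ioc ⌊A⌋₊ ⌊2 * A⌋₊)
      ((Finset.Icc 1 ⌊x / A⌋₊).filter (fun b : ℕ => b ≡ v q [MOD q]))
      (Finset.Icc 1 ⌊x / A⌋₊) (Finset.filter_subset _ _) (Finset.filter_subset _ _)
    have hq4 : (q : ℝ) ^ 4 ≤ Real.log x ^ (4 * K) := by
      calc (q : ℝ) ^ 4 ≤ (Real.log x ^ K) ^ 4 := by gcongr
        _ = Real.log x ^ (4 * K) := by
            rw [show (4 : ℝ) * K = K * 4 by ring, Real.rpow_mul hLpos.le,
              show ((4 : ℝ)) = ((4 : ℕ) : ℝ) by norm_num, Real.rpow_natCast]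
    have hpow : Real.log x ^ (C + 4 * K) = Real.log x ^ C * Real.log x ^ (4 * K) :=
      Real.rpow_add hLpos _ _
    have hL4K : 0 < Real.log x ^ (4 * K) := Real.rpow_pos_of_pos hLpos _
    have hLC : 0 < Real.log x ^ C := Real.rpow_pos_of_pos hLpos _
    calc (q : ℝ) ^ 4 * _ ≤ Real.log x ^ (4 * K) * (x ^ 2 / Real.log x ^ (C + 4 * K)) :=
          mul_le_mul hq4 (hsub.trans htable)
            (Finset.sum_nonneg fun _ _ => Finset.sum_nonneg fun _ _ => sq_nonneg _) hL4K.le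
      _ = x ^ 2 / Real.log x ^ C := by
          rw [hpow]; field_simp

end Summit.Parity.GeneralizedHardyLittlewood.Theorems.DilatedTableChowla.GenericCore
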